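import Literature.Analysis.FluidPDE.OnsagerBDSVGluedParams
import HarnessLib

/-!
# The BDSV scheme: the parameter inequalities of §6.1 (stress estimate)

Buckmaster–De Lellis–Székelyhidi–Vicol (BDSV), *Onsager's conjecture for admissible weak
solutions*, CPAM 72 (2019) = arXiv:1701.08678, estimate the new Reynolds stress in §6.1 mode by
mode through the stationary phase estimate Prop. C.2, and close the estimates with three
inequalities between the parameters `λ_q = BDSV.freq`, `δ_q = BDSV.amp`, `ℓ = BDSV.mollScale`,
`τ_q = BDSV.glueScale`, valid uniformly in `q` once `α` is small, a number `N` of derivatives is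
suitably chosen and `a` is large (§6.1.1, after arXiv (6.2)):

> "provided `α` is sufficiently small we claim that we can first fix a suitable `N` and then choose
> `a` large enough, so that `λ_{q+1}^{-(N-α)} ℓ^{-(N+α)} ≤ λ_{q+1}^{-(1-α)}`. Such choice is equivalent
> to `λ_{q+1}^{(N-1)-(N-α)β} ≥ λ_q^{(1-β+3α/2)(N+α)}` … we just need to verify the existence of `N`
> such that `b((N-1) - Nβ) > N(1-β)` … which … can certainly be satisfied for `N` large enough."
> (arXiv (6.4)) "We also implicitly used that `ℓ λ_{q+1} ≥ 1`, which is equivalent to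
> `λ_{q+1}^{1-β} ≥ λ_q^{1-β+3α/2}` … choosing first `α` so that `(b-1)(1-β) ≥ 3α` and then `a`
> sufficiently large."
> (§6.1.2) "`τ_q^{-1} = δ_q^{1/2} λ_q ℓ^{-2α}`", "`ℓ^{-2α} ≤ λ_q^{3α} ≤ λ_{q+1}^{3α}`".

This file PROVES them for the tree's parameters, from the master lemma
`BDSV.exists_freq_triple_le` (`OnsagerBDSVParameters.lean`):

* `BDSV.mollScale_inv_eq`: `ℓ⁻¹ = λ_{q+1}^β λ_q^{1-β+3α/2}` (the accepted `BDSV.glueScale_inv_eq` of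
  `OnsagerBDSVGluedParams.lean` gives `τ_q⁻¹ = δ_q^{1/2} λ_q ℓ^{-2α}`); `BDSV.glueScale_le_one`
  (`τ_q ≤ 1`, i.e. `τ_q⁻¹ ≥ 1`);
* `BDSV.exists_threshold_mollScale_freq_succ` (arXiv (6.4), with an arbitrary constant):
  for `3α/2 < (b-1)(1-β)` and every `K`, `K ≤ ℓ_q λ_{q+1}` for all `q` once `a` is large; hence
  `BDSV.exists_threshold_mollScale_rpow_le_freq_succ_rpow`: `ℓ^{-s} ≤ λ_{q+1}^s`, `s ≥ 0`;
* `BDSV.exists_phaseOrder` (the choice of `N`, §6.1.1): for `0 < β < 1 < b` there are `N ≥ 1` and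
  `α₀ > 0` such that for every `0 < α < α₀` and every `K`, for `a` large and all `q`,
  `K λ_{q+1}^{-(N-α)} ℓ^{-(N+α)} ≤ λ_{q+1}^{-(1-α)}`.

## References

* T. Buckmaster, C. De Lellis, L. Székelyhidi Jr., V. Vicol, *Onsager's conjecture for admissible
  weak solutions*, Comm. Pure Appl. Math. 72 (2019) 229–274 = arXiv:1701.08678, §6.1.1 (choice
  of `N`, arXiv (6.4)), §6.1.2 (`τ_q^{-1} = δ_q^{1/2}λ_qℓ^{-2α}`), §2.4 (`ℓ`), §2.5 (2.16) (`τ_q`),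
  §2.6 (2.25)–(2.26) (the mechanism). Equation numbers as in arXiv:1701.08678v1.
-/

open Set

noncomputable section

namespace Literature.Analysis.FluidPDE

namespace BDSV

variable {β α a b : ℝ}

/-! ## Algebra of `ℓ` and `τ_q` -/

section Algebra

/-- `ℓ⁻¹ = λ_{q+1}^β λ_q^{1-β+3α/2}` (from the definition `ℓ = δ_{q+1}^{1/2} δ_q^{-1/2} λ_q^{-1-3α/2}`,
`δ_q^{1/2} = λ_q^{-β}`), for `a ≥ 1`. [cite: BuckmasterEtAl2018, §2.4 (definition of ℓ)] -/
theorem mollScale_inv_eq (ha : 1 ≤ a) (q : ℕ) :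
    (mollScale β α a b q)⁻¹ = freq a b (q + 1) ^ β * freq a b q ^ (1 - β + 3 * α / 2) := by
  have hf0 := freq_pos (b := b) ha q
  have hf1 := freq_pos (b := b) ha (q + 1)
  rw [mollScale_eq ha, inv_div, ← Real.rpow_add hf0, Real.rpow_neg hf1.le, div_inv_eq_mul,
    mul_comm]
  congr 1
  congr 1
  ring

/-- `ℓ ≤ 1` (indeed `ℓ ≤ λ_q^{-1} ≤ 1`), for `a, b ≥ 1`, `β, α ≥ 0` (a private copy of
`BDSV.mollScale_le_one` of `OnsagerBDSVGluedEnergy.lean`, whose import closure is not wanted here).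
[folklore] -/
private theorem mollScale_le_one' (ha : 1 ≤ a) (hb : 1 ≤ b) (hβ : 0 ≤ β) (hα : 0 ≤ α) (q : ℕ) :
    mollScale β α a b q ≤ 1 :=
  (mollScale_le_freq_inv ha hb hβ hα q).trans (inv_le_one_of_one_le₀ (one_le_freq ha q))

/-- `τ_q ≤ 1` (`τ_q = ℓ^{2α} δ_q^{-1/2} λ_q^{-1} = ℓ^{2α} λ_q^{β-1} ≤ 1` for `β ≤ 1`), for `a, b ≥ 1`,
`0 ≤ β ≤ 1`, `α ≥ 0`; so `τ_q^{-1} ≥ 1`, as used in the proof of Prop. 5.9 ("`1 ≲ τ_q^{-1}`").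
[cite: BuckmasterEtAl2018, §5.5 (proof of Prop. 5.9)] -/
theorem glueScale_le_one (ha : 1 ≤ a) (hb : 1 ≤ b) (hβ : 0 ≤ β) (hβ1 : β ≤ 1) (hα : 0 ≤ α)
    (q : ℕ) : glueScale β α a b q ≤ 1 := by
  have hf0 := freq_pos (b := b) ha q
  have hℓ := mollScale_pos (β := β) (α := α) (b := b) ha q
  have h1 : mollScale β α a b q ^ (2 * α) ≤ 1 :=
    Real.rpow_le_one hℓ.le (mollScale_le_one' ha hb hβ hα q) (by linarith)
  have h2 : 1 ≤ Real.sqrt (amp β a b q) * freq a b q := by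
    rw [sqrt_amp ha, rpow_mul_self_eq hf0]
    exact Real.one_le_rpow (one_le_freq ha q) (by linarith)
  rw [glueScale, div_le_one (by positivity)]
  exact h1.trans h2

end Algebra

/-! ## arXiv (6.4): `ℓ λ_{q+1} ≥ 1` -/

section SixFour

/-- **arXiv (6.4) with an arbitrary constant**: if `3α/2 < (b-1)(1-β)` (the `a`-exponent of
`(ℓλ_{q+1})⁻¹ = λ_q^{1-β+3α/2} λ_{q+1}^{β-1}` is negative), then for every `K` there is a threshold
beyond which `K ≤ ℓ_q λ_{q+1}` for all `q` (BDSV: "`ℓ λ_{q+1} ≥ 1` … choosing first `α` so that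
`(b - 1)(1-β) ≥ 3α`, and then `a` sufficiently large"). [cite: BuckmasterEtAl2018, §6.1.1 (arXiv (6.4))] -/
theorem exists_threshold_mollScale_freq_succ (hb : 1 ≤ b) (hαb : 3 * α / 2 < (b - 1) * (1 - β))
    (K : ℝ) : ∃ a₁ : ℝ, 1 < a₁ ∧ ∀ a : ℝ, a₁ ≤ a → ∀ q : ℕ,
      K ≤ mollScale β α a b q * freq a b (q + 1) := by
  have hE : (1 - β + 3 * α / 2) + b * (β - 1) + b ^ 2 * 0 < 0 := by nlinarith
  obtain ⟨a₁, ha₁, h⟩ := exists_freq_triple_le hb hE K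
  refine ⟨a₁, ha₁, fun a ha q => ?_⟩
  have ha1 : (1 : ℝ) ≤ a := ha₁.le.trans ha
  have hf1 := freq_pos (b := b) ha1 (q + 1)
  have hℓ := mollScale_pos (β := β) (α := α) (b := b) ha1 q
  have key := h a ha q
  rw [Real.rpow_zero, mul_one] at key
  -- `λ_q^{1-β+3α/2} λ_{q+1}^{β-1} = (ℓ λ_{q+1})⁻¹`
  have hmon : freq a b q ^ (1 - β + 3 * α / 2) * freq a b (q + 1) ^ (β - 1) =
      (mollScale β α a b q * freq a b (q + 1))⁻¹ := by
    rw [mul_inv, mollScale_inv_eq ha1, show β - 1 = β + (-1) by ring, Real.rpow_add hf1,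
      Real.rpow_neg_one]
    ring
  rw [hmon] at key
  have hpos : 0 < mollScale β α a b q * freq a b (q + 1) := mul_pos hℓ hf1
  calc K = K * (mollScale β α a b q * freq a b (q + 1))⁻¹ * (mollScale β α a b q * freq a b (q + 1)) := by
        field_simp
    _ ≤ 1 * (mollScale β α a b q * freq a b (q + 1)) := mul_le_mul_of_nonneg_right key hpos.le
    _ = _ := one_mul _

/-- Consequently `ℓ^{-s} ≤ λ_{q+1}^{s}` for every `s ≥ 0` (`ℓ λ_{q+1} ≥ 1`), for `a` beyond the
threshold of arXiv (6.4) with `K = 1`; e.g. "`ℓ^{-2α} ≤ λ_{q+1}^{2α}`" in §6.1.2.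
[cite: BuckmasterEtAl2018, §6.1.1 (arXiv (6.4))] -/
theorem exists_threshold_mollScale_rpow_le_freq_succ_rpow (hb : 1 ≤ b)
    (hαb : 3 * α / 2 < (b - 1) * (1 - β)) :
    ∃ a₁ : ℝ, 1 < a₁ ∧ ∀ a : ℝ, a₁ ≤ a → ∀ (q : ℕ) (s : ℝ), 0 ≤ s →
      mollScale β α a b q ^ (-s) ≤ freq a b (q + 1) ^ s := by
  obtain ⟨a₁, ha₁, h⟩ := exists_threshold_mollScale_freq_succ hb hαb 1
  refine ⟨a₁, ha₁, fun a ha q s hs => ?_⟩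
  have ha1 : (1 : ℝ) ≤ a := ha₁.le.trans ha
  have hf1 := freq_pos (b := b) ha1 (q + 1)
  have hℓ := mollScale_pos (β := β) (α := α) (b := b) ha1 q
  have key : (mollScale β α a b q)⁻¹ ≤ freq a b (q + 1) := by
    rw [inv_le_iff_one_le_mul₀ hℓ]
    simpa [mul_comm] using h a ha q
  rw [Real.rpow_neg hℓ.le, ← Real.inv_rpow hℓ.le]
  exact Real.rpow_le_rpow (inv_nonneg.2 hℓ.le) key hs

end SixFour

/-! ## The choice of `N` (§6.1.1) -/

section PhaseOrder

/-- **The choice of `N` in §6.1.1.** For `0 < β < 1 < b` there are an order `N ≥ 1` and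
`α₀ > 0` such that for all `0 < α < α₀` and every constant `K`, once `a` is large,
`K λ_{q+1}^{-(N-α)} ℓ^{-(N+α)} ≤ λ_{q+1}^{-(1-α)}` for all `q` (BDSV: "provided `α` is sufficiently
small we … can first fix a suitable `N` and then choose `a` large enough … we just need to verify
the existence of `N` such that `b((N-1) - Nβ) > N(1-β)` … certainly satisfied for `N` large
enough"; here `N` is any integer with `N(1-β)(b-1) > b`, and the `a`-exponent
`(1-β+3α/2)(N+α) + b(β(N+α) - N + 1)` of `λ_q^{(1-β+3α/2)(N+α)} λ_{q+1}^{β(N+α)-N+1}` is negative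
for `α` small). [cite: BuckmasterEtAl2018, §6.1.1 (choice of N)] -/
theorem exists_phaseOrder (hβ : 0 < β) (hβ1 : β < 1) (hb : 1 < b) :
    ∃ N : ℕ, 1 ≤ N ∧ ∃ α₀ : ℝ, 0 < α₀ ∧ ∀ α : ℝ, 0 < α → α < α₀ → ∀ K : ℝ,
      ∃ a₁ : ℝ, 1 < a₁ ∧ ∀ a : ℝ, a₁ ≤ a → ∀ q : ℕ,
        K * (freq a b (q + 1) ^ (-((N : ℝ) - α)) * mollScale β α a b q ^ (-((N : ℝ) + α))) ≤
          freq a b (q + 1) ^ (-(1 - α)) := by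
  -- choose `N` with `N(1-β)(b-1) > b`
  have hden : 0 < (1 - β) * (b - 1) := mul_pos (by linarith) (by linarith)
  obtain ⟨N, hN⟩ := exists_nat_gt (b / ((1 - β) * (b - 1)))
  have hN1 : 1 ≤ N := by
    have hpos : (0 : ℝ) < b / ((1 - β) * (b - 1)) := div_pos (by linarith) hden
    have : (0 : ℝ) < N := hpos.trans hN
    exact Nat.one_le_iff_ne_zero.2 (by rintro rfl; simp at this)
  have hE0 : b - (N : ℝ) * ((1 - β) * (b - 1)) < 0 := by
    have := (div_lt_iff₀ hden).1 hN
    linarith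
  -- `E(α) ≤ E(0) + α D` for `α ≤ 1`, with `D = (1-β) + 3(N+1)/2 + bβ > 0`
  set E0 : ℝ := b - (N : ℝ) * ((1 - β) * (b - 1)) with hE0_def
  set D : ℝ := (1 - β) + 3 * ((N : ℝ) + 1) / 2 + b * β with hD_def
  have hD : 0 < D := by
    have : (0 : ℝ) ≤ N := N.cast_nonneg
    rw [hD_def]; nlinarith
  refine ⟨N, hN1, min 1 (-E0 / (2 * D)), lt_min one_pos (div_pos (by linarith) (by linarith)), ?_⟩
  intro α hα hαlt K
  have hα1 : α ≤ 1 := (hαlt.trans_le (min_le_left _ _)).le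
  have hαE : α < -E0 / (2 * D) := hαlt.trans_le (min_le_right _ _)
  have hαD : α * (2 * D) < -E0 := (lt_div_iff₀ (by linarith)).1 hαE
  -- the `a`-exponent of the normalised monomial
  have hE : (1 - β + 3 * α / 2) * ((N : ℝ) + α) + b * (β * ((N : ℝ) + α) - N + 1) + b ^ 2 * 0 < 0 := by
    have hNn : (0 : ℝ) ≤ N := N.cast_nonneg
    have h1 : (1 - β + 3 * α / 2) * ((N : ℝ) + α) + b * (β * ((N : ℝ) + α) - N + 1) =
        E0 + α * ((1 - β) + 3 * ((N : ℝ) + α) / 2 + b * β) := by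
      rw [hE0_def]; ring
    have h2 : α * ((1 - β) + 3 * ((N : ℝ) + α) / 2 + b * β) ≤ α * D := by
      refine mul_le_mul_of_nonneg_left ?_ hα.le
      rw [hD_def]; nlinarith
    nlinarith
  obtain ⟨a₁, ha₁, h⟩ := exists_freq_triple_le hb.le hE K
  refine ⟨a₁, ha₁, fun a ha q => ?_⟩
  have ha1 : (1 : ℝ) ≤ a := ha₁.le.trans ha
  have hf0 := freq_pos (b := b) ha1 q
  have hf1 := freq_pos (b := b) ha1 (q + 1)
  have hℓ := mollScale_pos (β := β) (α := α) (b := b) ha1 q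
  have key := h a ha q
  rw [Real.rpow_zero, mul_one] at key
  -- rewrite `ℓ^{-(N+α)}` and regroup the powers of `λ_{q+1}`
  have hℓpow : mollScale β α a b q ^ (-((N : ℝ) + α)) =
      freq a b (q + 1) ^ (β * ((N : ℝ) + α)) * freq a b q ^ ((1 - β + 3 * α / 2) * ((N : ℝ) + α)) := by
    rw [Real.rpow_neg hℓ.le, ← Real.inv_rpow hℓ.le, mollScale_inv_eq ha1,
      Real.mul_rpow (Real.rpow_nonneg hf1.le _) (Real.rpow_nonneg hf0.le _),
      ← Real.rpow_mul hf1.le, ← Real.rpow_mul hf0.le]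
  have hsplit : freq a b (q + 1) ^ (-((N : ℝ) - α)) * freq a b (q + 1) ^ (β * ((N : ℝ) + α)) =
      freq a b (q + 1) ^ (β * ((N : ℝ) + α) - N + 1) * freq a b (q + 1) ^ (-(1 - α)) := by
    rw [← Real.rpow_add hf1, ← Real.rpow_add hf1]
    congr 1
    ring
  have hW : 0 < freq a b (q + 1) ^ (-(1 - α)) := Real.rpow_pos_of_pos hf1 _
  calc K * (freq a b (q + 1) ^ (-((N : ℝ) - α)) * mollScale β α a b q ^ (-((N : ℝ) + α)))
      = K * ((freq a b (q + 1) ^ (-((N : ℝ) - α)) * freq a b (q + 1) ^ (β * ((N : ℝ) + α))) *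
          freq a b q ^ ((1 - β + 3 * α / 2) * ((N : ℝ) + α))) := by rw [hℓpow]; ring
    _ = (K * (freq a b q ^ ((1 - β + 3 * α / 2) * ((N : ℝ) + α)) *
          freq a b (q + 1) ^ (β * ((N : ℝ) + α) - N + 1))) * freq a b (q + 1) ^ (-(1 - α)) := by
          rw [hsplit]; ring
    _ ≤ 1 * freq a b (q + 1) ^ (-(1 - α)) := mul_le_mul_of_nonneg_right key hW.le
    _ = _ := one_mul _

end PhaseOrder

end BDSV

end Literature.Analysis.FluidPDE
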